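import Summits.QuantumFields.BalabanUV.Beta.GAN24.WoodburyFibreLandauLimit
import Literature.MathematicalPhysics.QuantumFieldTheory.Balaban1983to89.Beta.BiLaplaceBlockGreen

/-!
# Beta / GAN24 / WoodburyFibreLandauZd — census row V10 CLOSED: the Neumann-box theorem of `GAN24/WoodburyFibreLandauBox`
carried to `ℤ^{d+1}` — **an2's block-constrained inverse `Sb` of the squared lattice Laplacian (brick (G″), `Beta/BiLaplaceBlockKKT`)
decays exponentially in block units with constants UNIFORM ALONG THE SCALES `N = L^k`**

Cell `pub-balaban`, β sub-cell, BINDER ROW **G-an2-4 ∕ (CONV-C)** («NOT IN PRINT; our proof attempt»), prover part **P3 =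
WOODBURY-FIBRE reduction** (lineage `b2b-balaban-gan24-p3`, gen 6).  HONEST FRAMING (verbatim): discharging `BetaPertH`
makes Bałaban's UV stability UNCONDITIONAL — a real constructive-QFT result; it is NOT the continuum limit and NOT the Clay
problem.  HONEST DEPENDENCY: continuum YM on T⁴ ⇐ BetaPertH ∧ nine spine estimates (0/9 proved); BetaPertH ⇐ (D1) ∧ (D4) ∧
CAP+tail; G-an2-4 gates asym, D1 and NE2/3/4.  `[folklore]`; 0 sorry; nothing printed and nothing programme-internal is used
as a hypothesis; an2's files are imported BY NAME, not edited.  NOT (CONV-C), NOT «G-an2-4 closed», NOT `BetaPertH`.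

STATEMENT (`Sb_decay_uniform`): for every `d` and `L = ℓ + 1 ≥ 2` there are `δ, C > 0` such that for EVERY `k ≥ 1`, `N = L^k`,
an2's `Sb N x x'` — the field at `x` of the unique tempered solution of `L(Lλ) = ω∘quo_N + δ_{x'}`, `blockSum_N λ = 0` on
`ℤ^{d+1}` (`L = codiff₁ ∘ dz`; the `U = 1` scalar operator of Bałaban's Landau-type block gauge, AN2.md §16) — obeys
`|Sb N x x'| ≤ C·N⁴·e^{−δ·|quo_N x − quo_N x'|_∞}`, and in Bałaban's cube currency `blockSum_N |Sb N x ·| b' ≤ C·N⁴·e^{−δ|quo_N x − b'|_∞}`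
(`Sb_blockSum_decay_uniform`); `N⁴` = natural size for the fourth-order `L∘L` on the unit lattice; rate and relative constant uniform in `k`.
PROOF (the box → `ℤ^{d+1}` dictionary): kernels `K_R(x, x') = n⁴·Γ_R(x + Rn𝟙, x' + Rn𝟙)` of the re-centred Neumann boxes
`[−Rn, Rn)^{d+1}` (`Γ_R` = `WoodburyFibreLandauLimit.landauCov`), bounded by `n⁴C·e^{−δ|blk x − blk x'|_∞}` uniformly in `R`
(`landau_box_cubeDecay_indB`, all scales); a pointwise subsequential limit `K` exists (`exists_subseq_pointwise_limit`), keeps the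
bound, satisfies `L(L K(·,x'))(x) − δ_{x x'} =` a function of `blk x` (box KKT identity at eventually-`2`-interior points) and has
zero block sums (eventually-interior blocks); it is tempered, so an2's `BiLaplaceBlockGreen.eq_Sb_of_solvesB` identifies it with `Sb`.
-/

namespace Summit.QuantumFields.BalabanUV.Beta.GAN24.WoodburyFibreLandauZd

open Filter Topology Finset Matrix
open Literature.MathematicalPhysics.QuantumFieldTheory
open Literature.MathematicalPhysics.QuantumFieldTheory.Balaban1983to89
open B4ContourShift (supNorm supNorm_nonneg abs_le_supNorm)
open B4Reflection242 (boxDom mem_boxDom blk nbrs mem_nbrs supNorm_le_of_forall)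
open B4BoxCov237 (boxOpR indB rho extB extB_of_mem extB_of_not_mem boxOpR_isUnit)
open Beta.AffineAveraging (dz codiff₁ unitVec box toSite blockSum)
open Beta.KKTFluctuationUnique (Tempered0 Tempered0.of_bounded)
open Beta.ScalarBlockGreen (δS)
open Beta.BiLaplaceBlockKKT (Sb)
open Beta.BiLaplaceBlockGreen (SolvesB eq_Sb_of_solvesB)
open LatticeForm (quo)
open Summit.QuantumFields.BalabanUV.Beta.PropagatorWoodburyFibre (flucCov)
open WoodburyFibreGaugeCubeDecay (CubeDecay)
open WoodburyFibreBoxQGQ (fineN blkBox blkBox_val)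
open WoodburyFibreLandauBox (landau_box_cubeDecay_indB)
open WoodburyFibreLandauLimit

noncomputable section

variable {d : ℕ}

/-! ## §1 The kernel sequence `K_R` and its uniform bound -/

/-- an2's block label `quo n` is the box lineage's `blk n` (both are coordinatewise floor division). [folklore] -/
theorem quo_eq_blk (n : ℕ) (x : Fin (d + 1) → ℤ) : quo n x = blk n x := rfl


/-- reindexing an2's offset box `box (d+1) n ⊂ (Fin (d+1) → ℕ)` by `Fin (d+1) → Fin n`. [folklore] -/
theorem sum_box_eq_sum_fin (n : ℕ) (F : (Fin (d + 1) → ℕ) → ℝ) :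
    ∑ b ∈ box (d + 1) n, F b = ∑ j : Fin (d + 1) → Fin n, F (fun i => (j i : ℕ)) := by
  classical
  refine Finset.sum_bij' (fun b hb => fun i => ⟨b i, Finset.mem_range.1 (Fintype.mem_piFinset.1 hb i)⟩)
    (fun j _ => fun i => (j i : ℕ)) ?_ ?_ ?_ ?_ ?_
  · intro b hb; exact Finset.mem_univ _
  · intro j hj; exact Fintype.mem_piFinset.2 fun i => Finset.mem_range.2 (j i).isLt
  · intro b hb; rfl
  · intro j hj; rfl
  · intro b hb; rfl

/-- **the re-centred box Landau kernels** `K_R(x, x') = n⁴·Γ_R(x + Rn𝟙, x' + Rn𝟙)` (zero off the box). [folklore] -/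
def KR (n R : ℕ) (x x' : Fin (d + 1) → ℤ) : ℝ :=
  if h : x + shiftF d n R ∈ boxDom (fineN n (cubeM d R)) ∧ x' + shiftF d n R ∈ boxDom (fineN n (cubeM d R)) then
    (n : ℝ) ^ 4 * landauCov n (cubeM d R) ⟨x + shiftF d n R, h.1⟩ ⟨x' + shiftF d n R, h.2⟩
  else 0

/-- the column of `K_R` at `x'` is the translate of `n⁴·`(the zero-extended column of `Γ_R`). [folklore] -/
theorem KR_col_eq {n R : ℕ} {x' : Fin (d + 1) → ℤ} (hx' : x' + shiftF d n R ∈ boxDom (fineN n (cubeM d R)))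
    (z : Fin (d + 1) → ℤ) :
    KR n R z x' = (n : ℝ) ^ 4 * extB (fineN n (cubeM d R))
      (fun w => landauCov n (cubeM d R) w ⟨x' + shiftF d n R, hx'⟩) (z + shiftF d n R) := by
  unfold KR
  by_cases hz : z + shiftF d n R ∈ boxDom (fineN n (cubeM d R))
  · rw [dif_pos ⟨hz, hx'⟩, extB_of_mem _ hz]
  · rw [dif_neg (fun h => hz h.1), extB_of_not_mem _ hz, mul_zero]

/-- **UNIFORM BOUND** on the kernel sequence from a cube-decay bound of the box Landau operator. [folklore] -/
theorem KR_abs_le {n : ℕ} (hn : 1 ≤ n) {R : ℕ} {C δ : ℝ}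
    (hΓ : CubeDecay (rho (cubeM d R)) (blkBox hn (cubeM d R)) id (landauCov n (cubeM d R)) C δ)
    (x x' : Fin (d + 1) → ℤ) :
    |KR n R x x'| ≤ (n : ℝ) ^ 4 * C * Real.exp (-(δ * supNorm (blk n x - blk n x'))) := by
  have hC := hΓ.1
  unfold KR
  split_ifs with h
  · rw [abs_mul, abs_of_nonneg (by positivity)]
    rw [mul_assoc]
    refine mul_le_mul_of_nonneg_left ?_ (by positivity)
    have hrow := hΓ.2 ⟨x + shiftF d n R, h.1⟩ (blkBox hn (cubeM d R) ⟨x' + shiftF d n R, h.2⟩)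
    have hmem : (⟨x' + shiftF d n R, h.2⟩ : ↥(boxDom (fineN n (cubeM d R))))
        ∈ Finset.univ.filter (fun y => blkBox hn (cubeM d R) y = blkBox hn (cubeM d R) ⟨x' + shiftF d n R, h.2⟩) := by
      simp
    have hsingle := Finset.single_le_sum (f := fun y => |landauCov n (cubeM d R) ⟨x + shiftF d n R, h.1⟩ y|)
      (fun y _ => abs_nonneg _) hmem
    have hdist : rho (cubeM d R) (id (blkBox hn (cubeM d R) ⟨x + shiftF d n R, h.1⟩))
        (id (blkBox hn (cubeM d R) ⟨x' + shiftF d n R, h.2⟩)) = supNorm (blk n x - blk n x') := by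
      simp only [id, rho, blkBox_val, blk_add_shiftF hn, add_sub_add_right_eq_sub]
    rw [hdist] at hrow
    exact hsingle.trans hrow
  · rw [abs_zero]; positivity

/-- the row of `K_R` at `x` is the translate of `n⁴·`(the zero-extended row of `Γ_R`). [folklore] -/
theorem KR_row_eq {n R : ℕ} {x : Fin (d + 1) → ℤ} (hx : x + shiftF d n R ∈ boxDom (fineN n (cubeM d R)))
    (y : Fin (d + 1) → ℤ) :
    KR n R x y = (n : ℝ) ^ 4 * extB (fineN n (cubeM d R))
      (fun w => landauCov n (cubeM d R) ⟨x + shiftF d n R, hx⟩ w) (y + shiftF d n R) := by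
  unfold KR
  by_cases hy : y + shiftF d n R ∈ boxDom (fineN n (cubeM d R))
  · rw [dif_pos ⟨hx, hy⟩, extB_of_mem _ hy]
  · rw [dif_neg (fun h => hy h.2), extB_of_not_mem _ hy, mul_zero]

/-- **UNIFORM CUBE BOUND** on the kernel sequence: the rows of `K_R` summed in absolute value over any block. [folklore] -/
theorem KR_blockAbsSum_le {n : ℕ} [NeZero n] (hn : 1 ≤ n) {R : ℕ} {C δ : ℝ}
    (hΓ : CubeDecay (rho (cubeM d R)) (blkBox hn (cubeM d R)) id (landauCov n (cubeM d R)) C δ)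
    (x b' : Fin (d + 1) → ℤ) :
    ∑ b ∈ box (d + 1) n, |KR n R x ((n : ℤ) • b' + toSite b)|
      ≤ (n : ℝ) ^ 4 * C * Real.exp (-(δ * supNorm (blk n x - b'))) := by
  have hC := hΓ.1
  have hRHS : 0 ≤ (n : ℝ) ^ 4 * C * Real.exp (-(δ * supNorm (blk n x - b'))) := by positivity
  by_cases hx : x + shiftF d n R ∈ boxDom (fineN n (cubeM d R))
  · set row : ↥(boxDom (fineN n (cubeM d R))) → ℝ := fun w => landauCov n (cubeM d R) ⟨x + shiftF d n R, hx⟩ w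
      with hrow
    have hpt : ∀ b : Fin (d + 1) → ℕ, |KR n R x ((n : ℤ) • b' + toSite b)|
        = (n : ℝ) ^ 4 * extB (fineN n (cubeM d R)) (fun w => |row w|) ((n : ℤ) • b' + toSite b + shiftF d n R) := by
      intro b; rw [KR_row_eq hx, abs_mul, abs_of_nonneg (by positivity), abs_extB]
    simp_rw [hpt]
    rw [← Finset.mul_sum, sum_box_eq_sum_fin n
      (fun b => extB (fineN n (cubeM d R)) (fun w => |row w|) ((n : ℤ) • b' + toSite b + shiftF d n R))]
    have hfp : ∀ j : Fin (d + 1) → Fin n, (n : ℤ) • b' + toSite (fun i => (j i : ℕ)) + shiftF d n R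
        = B4Green244.finePt n (b' + shiftB d R) j := by
      intro j; funext i
      simp only [Pi.add_apply, Pi.smul_apply, smul_eq_mul, toSite, shiftF, shiftB, B4Green244.finePt]
      ring
    simp_rw [hfp]
    by_cases hb : b' + shiftB d R ∈ boxDom (cubeM d R)
    · have hchart := (B4BoxCov237.indB_mulVec_eq_chartSum hn (cubeM d R) (fun w => |row w|) ⟨b' + shiftB d R, hb⟩).symm
      have hfib : (indB n (cubeM d R) *ᵥ fun w => |row w|) ⟨b' + shiftB d R, hb⟩
          = ∑ z ∈ Finset.univ.filter (fun z => blkBox hn (cubeM d R) z = ⟨b' + shiftB d R, hb⟩), |row z| := by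
        rw [B4BoxCov237.indB_mulVec]
        refine Finset.sum_congr ?_ fun _ _ => rfl
        ext z; simp only [Finset.mem_filter, Finset.mem_univ, true_and, Subtype.ext_iff, blkBox_val]
      rw [hchart, hfib]
      have hdec := hΓ.2 ⟨x + shiftF d n R, hx⟩ ⟨b' + shiftB d R, hb⟩
      have hdist : rho (cubeM d R) (id (blkBox hn (cubeM d R) ⟨x + shiftF d n R, hx⟩)) (id ⟨b' + shiftB d R, hb⟩)
          = supNorm (blk n x - b') := by
        simp only [id, rho, blkBox_val, blk_add_shiftF hn, add_sub_add_right_eq_sub]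
      rw [hdist] at hdec
      rw [mul_assoc]
      exact mul_le_mul_of_nonneg_left hdec (by positivity)
    · -- the block is outside the unit cube: every term vanishes
      have hzero : ∀ j : Fin (d + 1) → Fin n, extB (fineN n (cubeM d R)) (fun w => |row w|)
          (B4Green244.finePt n (b' + shiftB d R) j) = 0 := by
        intro j
        apply extB_of_not_mem
        intro hmem
        apply hb
        have := B4Reflection242.blk_mem_boxDom hn hmem
        rwa [B4BoxCov237.blk_finePt hn] at this
      simp_rw [hzero]
      rw [Finset.sum_const_zero, mul_zero]
      exact hRHS
  · have hzero : ∀ b : Fin (d + 1) → ℕ, |KR n R x ((n : ℤ) • b' + toSite b)| = 0 := by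
      intro b; unfold KR; rw [dif_neg (fun h => hx h.1), abs_zero]
    simp_rw [hzero]
    rw [Finset.sum_const_zero]
    exact hRHS

/-! ## §2 The equations satisfied by `K_R` at interior points -/

/-- **THE (EL) IDENTITY OF `K_R` AT A `2`-INTERIOR POINT**: `L(L K_R(·, x'))(x) = δ_{x x'} − C_R(blk(x + Rn𝟙), x' + Rn𝟙)`.
[folklore] -/
theorem lapSq_KR_eq {n : ℕ} (hn : 1 ≤ n) {R : ℕ} (hR : 1 ≤ R) {x x' : Fin (d + 1) → ℤ}
    (h2 : ∀ z, supNorm (z - x) ≤ 2 → z + shiftF d n R ∈ boxDom (fineN n (cubeM d R)))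
    (hx : x + shiftF d n R ∈ boxDom (fineN n (cubeM d R)))
    (hx' : x' + shiftF d n R ∈ boxDom (fineN n (cubeM d R))) :
    codiff₁ (dz (codiff₁ (dz (fun z => KR n R z x')))) x
      = (if x = x' then 1 else 0)
        - landauCo n (cubeM d R) (blkBox hn (cubeM d R) ⟨x + shiftF d n R, hx⟩) ⟨x' + shiftF d n R, hx'⟩ := by
  have hM : ∀ i, 1 ≤ cubeM d R i := fun i => by simp only [cubeM]; omega
  set col : ↥(boxDom (fineN n (cubeM d R))) → ℝ := fun w => landauCov n (cubeM d R) w ⟨x' + shiftF d n R, hx'⟩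
    with hcol
  have hK : (fun z => KR n R z x') = fun z => (n : ℝ) ^ 4 * extB (fineN n (cubeM d R)) col (z + shiftF d n R) :=
    funext fun z => KR_col_eq hx' z
  have h2' : ∀ z, supNorm (z - (x + shiftF d n R)) ≤ 2 → z ∈ boxDom (fineN n (cubeM d R)) := by
    intro z hz
    have := h2 (z - shiftF d n R) (by rwa [sub_sub, add_comm (shiftF d n R) x])
    rwa [sub_add_cancel] at this
  have hstep1 : codiff₁ (dz (fun z => KR n R z x'))
      = fun z => codiff₁ (dz (fun w => (n : ℝ) ^ 4 * extB (fineN n (cubeM d R)) col w)) (z + shiftF d n R) := by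
    funext z; rw [hK]
    exact lap_translate (fun w => (n : ℝ) ^ 4 * extB (fineN n (cubeM d R)) col w) (shiftF d n R) z
  rw [hstep1, lap_translate]
  have hstep2 : codiff₁ (dz (fun w => (n : ℝ) ^ 4 * extB (fineN n (cubeM d R)) col w))
      = fun w => (n : ℝ) ^ 4 * codiff₁ (dz (extB (fineN n (cubeM d R)) col)) w := funext fun w => lap_smul _ _ w
  rw [hstep2, lap_smul]
  have hsq := boxLapSq_interior col ⟨x + shiftF d n R, hx⟩ h2'
  have hkkt := landau_kkt_entry hn (cubeM d R) hM ⟨x + shiftF d n R, hx⟩ ⟨x' + shiftF d n R, hx'⟩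
  rw [← mulVec_col, hsq] at hkkt
  have hiff : ((⟨x + shiftF d n R, hx⟩ : ↥(boxDom (fineN n (cubeM d R)))) = ⟨x' + shiftF d n R, hx'⟩) ↔ x = x' := by
    rw [Subtype.ext_iff]; exact add_left_inj _
  by_cases hxx : x = x'
  · rw [if_pos hxx]; rw [if_pos (hiff.2 hxx)] at hkkt; linarith
  · rw [if_neg hxx]; rw [if_neg (fun h => hxx (hiff.1 h))] at hkkt; linarith

/-- **THE (M) IDENTITY OF `K_R`**: the columns of `K_R` have zero block sums on every block inside the unit cube. [folklore] -/
theorem blockSum_KR_eq_zero {n : ℕ} (hn : 1 ≤ n) {R : ℕ} (hR : 1 ≤ R) {y x' : Fin (d + 1) → ℤ}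
    (hy : y + shiftB d R ∈ boxDom (cubeM d R)) (hx' : x' + shiftF d n R ∈ boxDom (fineN n (cubeM d R))) :
    blockSum n (fun z => KR n R z x') y = 0 := by
  have hM : ∀ i, 1 ≤ cubeM d R i := fun i => by simp only [cubeM]; omega
  set col : ↥(boxDom (fineN n (cubeM d R))) → ℝ := fun w => landauCov n (cubeM d R) w ⟨x' + shiftF d n R, hx'⟩
    with hcol
  have hSΓ : indB n (cubeM d R) * landauCov n (cubeM d R) = 0 :=
    PropagatorWoodburyFibre.constraint_mul_flucCov (isUnit_landauPivot hn (cubeM d R) hM)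
  have hzero : (indB n (cubeM d R) *ᵥ col) ⟨y + shiftB d R, hy⟩ = 0 := by
    rw [hcol, mulVec_col, hSΓ, Matrix.zero_apply]
  rw [B4BoxCov237.indB_mulVec_eq_chartSum hn] at hzero
  unfold blockSum
  have hpt : ∀ b : Fin (d + 1) → ℕ, KR n R ((n : ℤ) • y + toSite b) x'
      = (n : ℝ) ^ 4 * extB (fineN n (cubeM d R)) col ((n : ℤ) • y + toSite b + shiftF d n R) := fun b => KR_col_eq hx' _
  simp_rw [hpt]
  rw [← Finset.mul_sum, sum_box_eq_sum_fin n
    (fun b => extB (fineN n (cubeM d R)) col ((n : ℤ) • y + toSite b + shiftF d n R))]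
  have hfp : ∀ j : Fin (d + 1) → Fin n, (n : ℤ) • y + toSite (fun i => (j i : ℕ)) + shiftF d n R
      = B4Green244.finePt n (y + shiftB d R) j := by
    intro j; funext i
    simp only [Pi.add_apply, Pi.smul_apply, smul_eq_mul, toSite, shiftF, shiftB, B4Green244.finePt]
    ring
  simp_rw [hfp]
  rw [hzero, mul_zero]

/-! ## §3 Passage to the limit along growing boxes and identification with an2's `Sb` -/

/-- the canonical representative `n•y` of block `y`. [folklore] -/
theorem blk_zsmul {n : ℕ} (hn : 1 ≤ n) (y : Fin (d + 1) → ℤ) : blk n ((n : ℤ) • y) = y := by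
  have hn0 : (n : ℤ) ≠ 0 := by exact_mod_cast (by omega : n ≠ 0)
  funext i
  simp only [blk, Pi.smul_apply, smul_eq_mul]
  exact Int.mul_ediv_cancel_left _ hn0

/-- **ONE SCALE**: if the box Landau operators on all the cubes `[0, 2Rn)^{d+1}` obey one cube-decay bound `(C, δ)`, then an2's
infinite-volume kernel obeys `|Sb n x x'| ≤ n⁴·C·e^{−δ|blk x − blk x'|_∞}` and, in the cube currency,
`Σ_{blk y = b'} |Sb n x y| ≤ n⁴·C·e^{−δ|blk x − b'|_∞}`. [folklore] -/
theorem Sb_decay_of_boxDecay {n : ℕ} [NeZero n] (hn : 1 ≤ n) {C δ : ℝ} (hδ : 0 ≤ δ)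
    (hbox : ∀ R, 1 ≤ R → CubeDecay (rho (cubeM d R)) (blkBox hn (cubeM d R)) id (landauCov n (cubeM d R)) C δ) :
    (∀ x x' : Fin (d + 1) → ℤ, |Sb (N := n) x x'| ≤ (n : ℝ) ^ 4 * C * Real.exp (-(δ * supNorm (blk n x - blk n x')))) ∧
    ∀ x b' : Fin (d + 1) → ℤ, blockSum n (fun y => |Sb (N := n) x y|) b'
      ≤ (n : ℝ) ^ 4 * C * Real.exp (-(δ * supNorm (blk n x - b'))) := by
  have hC : 0 ≤ C := (hbox 1 le_rfl).1
  obtain ⟨g, φ, hφ, hlim, hbd⟩ := exists_subseq_pointwise_limit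
    (fun R (p : (Fin (d + 1) → ℤ) × (Fin (d + 1) → ℤ)) => KR n (R + 1) p.1 p.2)
    (fun p => (n : ℝ) ^ 4 * C * Real.exp (-(δ * supNorm (blk n p.1 - blk n p.2))))
    (fun R p => KR_abs_le hn (hbox (R + 1) (by omega)) p.1 p.2)
  have hφge : ∀ R, R ≤ φ R := fun R => hφ.id_le R
  have hself : ∀ z : Fin (d + 1) → ℤ, supNorm (z - z) ≤ 2 := fun z => by
    rw [sub_self]; exact supNorm_le_of_forall fun j => by simp
  -- identification of every column of the limit with an2's `Sb`
  have hid : ∀ x' z, g (z, x') = Sb (N := n) z x' := by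
    intro x'
    set lam : (Fin (d + 1) → ℤ) → ℝ := fun z => g (z, x') with hlamdef
    have hlimz : ∀ z, Tendsto (fun R => KR n (φ R + 1) z x') atTop (𝓝 (lam z)) := fun z => hlim (z, x')
    have hlam_bd : ∀ z, |lam z| ≤ (n : ℝ) ^ 4 * C := by
      intro z
      have h1 := hbd (z, x')
      have h2 : Real.exp (-(δ * supNorm (blk n z - blk n x'))) ≤ 1 :=
        Real.exp_le_one_iff.2 (by nlinarith [supNorm_nonneg (blk n z - blk n x')])
      calc |lam z| ≤ (n : ℝ) ^ 4 * C * Real.exp (-(δ * supNorm (blk n z - blk n x'))) := h1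
        _ ≤ (n : ℝ) ^ 4 * C * 1 := mul_le_mul_of_nonneg_left h2 (by positivity)
        _ = _ := mul_one _
    have hLL : ∀ z, Tendsto (fun R => codiff₁ (dz (codiff₁ (dz (fun w => KR n (φ R + 1) w x')))) z) atTop
        (𝓝 (codiff₁ (dz (codiff₁ (dz lam))) z)) := tendsto_lap (tendsto_lap hlimz)
    have hbc : ∀ z₁ z₂, blk n z₁ = blk n z₂ →
        codiff₁ (dz (codiff₁ (dz lam))) z₁ - δS x' z₁ = codiff₁ (dz (codiff₁ (dz lam))) z₂ - δS x' z₂ := by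
      intro z₁ z₂ hb
      obtain ⟨R₁, hR₁⟩ := eventually_two_nbhd (d := d) hn z₁
      obtain ⟨R₂, hR₂⟩ := eventually_two_nbhd (d := d) hn z₂
      obtain ⟨R₃, hR₃⟩ := eventually_two_nbhd (d := d) hn x'
      have hev : ∀ᶠ R in atTop,
          (codiff₁ (dz (codiff₁ (dz (fun w => KR n (φ R + 1) w x')))) z₁ - δS x' z₁)
            - (codiff₁ (dz (codiff₁ (dz (fun w => KR n (φ R + 1) w x')))) z₂ - δS x' z₂) = 0 := by
        refine Filter.eventually_atTop.2 ⟨R₁ + R₂ + R₃, fun R hR => ?_⟩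
        have hge := hφge R
        have h2₁ := hR₁ (φ R + 1) (by omega)
        have h2₂ := hR₂ (φ R + 1) (by omega)
        have hx'm := hR₃ (φ R + 1) (by omega) x' (hself x')
        have hz₁ := h2₁ z₁ (hself z₁)
        have hz₂ := h2₂ z₂ (hself z₂)
        rw [lapSq_KR_eq hn (by omega) h2₁ hz₁ hx'm, lapSq_KR_eq hn (by omega) h2₂ hz₂ hx'm]
        have hbb : blkBox hn (cubeM d (φ R + 1)) ⟨z₁ + shiftF d n (φ R + 1), hz₁⟩
            = blkBox hn (cubeM d (φ R + 1)) ⟨z₂ + shiftF d n (φ R + 1), hz₂⟩ :=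
          Subtype.ext (by simp only [blkBox_val, blk_add_shiftF hn, hb])
        rw [hbb]
        simp only [δS]
        ring
      have hconv : Tendsto (fun R =>
          (codiff₁ (dz (codiff₁ (dz (fun w => KR n (φ R + 1) w x')))) z₁ - δS x' z₁)
            - (codiff₁ (dz (codiff₁ (dz (fun w => KR n (φ R + 1) w x')))) z₂ - δS x' z₂)) atTop
          (𝓝 ((codiff₁ (dz (codiff₁ (dz lam))) z₁ - δS x' z₁) - (codiff₁ (dz (codiff₁ (dz lam))) z₂ - δS x' z₂))) :=
        ((hLL z₁).sub_const _).sub ((hLL z₂).sub_const _)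
      have huniq := tendsto_nhds_unique hconv (tendsto_const_nhds.congr' (hev.mono fun R h => h.symm))
      linarith
    set ω : (Fin (d + 1) → ℤ) → ℝ := fun y => codiff₁ (dz (codiff₁ (dz lam))) ((n : ℤ) • y) - δS x' ((n : ℤ) • y)
      with hωdef
    have hel : ∀ z, codiff₁ (dz (codiff₁ (dz lam))) z = ω (quo n z) + δS x' z := by
      intro z
      have h := hbc z ((n : ℤ) • quo n z) (by rw [quo_eq_blk, blk_zsmul hn])
      rw [hωdef]
      linarith
    have hmean : ∀ y, blockSum n lam y = 0 := by
      intro y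
      obtain ⟨R₁, hR₁⟩ := eventually_block (d := d) hn y
      obtain ⟨R₃, hR₃⟩ := eventually_two_nbhd (d := d) hn x'
      have hev : ∀ᶠ R in atTop, blockSum n (fun z => KR n (φ R + 1) z x') y = 0 := by
        refine Filter.eventually_atTop.2 ⟨R₁ + R₃, fun R hR => ?_⟩
        have hge := hφge R
        exact blockSum_KR_eq_zero hn (by omega) (hR₁ (φ R + 1) (by omega)).1 (hR₃ (φ R + 1) (by omega) x' (hself x'))
      have hconv : Tendsto (fun R => blockSum n (fun z => KR n (φ R + 1) z x') y) atTop (𝓝 (blockSum n lam y)) := by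
        unfold blockSum
        exact tendsto_finsetSum _ fun b _ => hlimz _
      exact tendsto_nhds_unique hconv (tendsto_const_nhds.congr' (hev.mono fun R h => h.symm))
    have hsol : SolvesB n (δS x') 0 lam ω := ⟨hel, fun y => by rw [Pi.zero_apply]; exact hmean y⟩
    have hlamT : Tempered0 lam := Tempered0.of_bounded hlam_bd
    have hωT : Tempered0 ω := by
      refine Tempered0.of_bounded (B := 4 * ((d : ℝ) + 1) * (4 * ((d : ℝ) + 1) * ((n : ℝ) ^ 4 * C)) + 1) fun y => ?_
      have h1 : ∀ z, |codiff₁ (dz lam) z| ≤ 4 * ((d : ℝ) + 1) * ((n : ℝ) ^ 4 * C) := fun z => abs_lap_le z hlam_bd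
      have h2 := abs_lap_le ((n : ℤ) • y) h1
      have h3 : |δS x' ((n : ℤ) • y)| ≤ 1 := by simp only [δS]; split_ifs <;> simp
      rw [hωdef]
      calc |codiff₁ (dz (codiff₁ (dz lam))) ((n : ℤ) • y) - δS x' ((n : ℤ) • y)|
          ≤ |codiff₁ (dz (codiff₁ (dz lam))) ((n : ℤ) • y)| + |δS x' ((n : ℤ) • y)| := abs_sub _ _
        _ ≤ _ := add_le_add h2 h3
    exact fun z => eq_Sb_of_solvesB hsol hlamT hωT z
  refine ⟨fun x x' => ?_, fun x b' => ?_⟩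
  · rw [← hid x' x]; exact hbd (x, x')
  · have hfun : (fun y => |Sb (N := n) x y|) = fun y => |g (x, y)| := funext fun y => by rw [hid y x]
    have hconv : Tendsto (fun R => ∑ b ∈ box (d + 1) n, |KR n (φ R + 1) x ((n : ℤ) • b' + toSite b)|) atTop
        (𝓝 (∑ b ∈ box (d + 1) n, |g (x, (n : ℤ) • b' + toSite b)|)) :=
      tendsto_finsetSum _ fun b _ => (hlim (x, _)).abs
    rw [hfun]
    unfold blockSum
    exact le_of_tendsto' hconv fun R => KR_blockAbsSum_le hn (hbox (φ R + 1) (by omega)) x b'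

/-- **AN2'S `Sb` DECAYS UNIFORMLY ALONG THE SCALES `N = L^k`** (census row V10 = the box → `ℤ^{d+1}` dictionary of row V9):
for every `d` and `L = ℓ+1 ≥ 2` there are `δ, C > 0` with `|Sb N x x'| ≤ C·N⁴·e^{−δ|quo_N x − quo_N x'|_∞}` for EVERY
`k ≥ 1`, `N = L^k`, and all `x, x' ∈ ℤ^{d+1}`; `(δ, C)` are those of `WoodburyFibreLandauBox.landau_box_cubeDecay_indB`
(B4 (1.10) on boxes + the box (2.76) coercivity + R20), hence explicit functions of `(d, ℓ)`; no numerical value is claimed.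
NOT (CONV-C), NOT `BetaPertH`. [folklore] -/
theorem Sb_decay_uniform (d ℓ : ℕ) (hℓ : 1 ≤ ℓ) :
    ∃ δ C : ℝ, 0 < δ ∧ 0 < C ∧ ∀ (k : ℕ), 1 ≤ k → ∀ x x' : Fin (d + 1) → ℤ,
      |Sb (N := (ℓ + 1) ^ k) x x'|
        ≤ C * (((ℓ + 1) ^ k : ℕ) : ℝ) ^ 4 * Real.exp (-(δ * supNorm (quo ((ℓ + 1) ^ k) x - quo ((ℓ + 1) ^ k) x'))) := by
  obtain ⟨δ, C, hδ, hC, h⟩ := landau_box_cubeDecay_indB d ℓ hℓ (m2plus := 0) le_rfl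
  refine ⟨δ, C, hδ, hC, fun k hk x x' => ?_⟩
  have hn : 1 ≤ (ℓ + 1) ^ k := Nat.one_le_pow k (ℓ + 1) (Nat.succ_pos ℓ)
  have hbox : ∀ R, 1 ≤ R →
      CubeDecay (rho (cubeM d R)) (blkBox hn (cubeM d R)) id (landauCov ((ℓ + 1) ^ k) (cubeM d R)) C δ := by
    intro R hR
    exact h k hk 0 le_rfl le_rfl (cubeM d R) (fun i => by simp only [cubeM]; omega) 1 one_pos
  have hmain := (Sb_decay_of_boxDecay hn hδ.le hbox).1 x x'
  rw [quo_eq_blk, quo_eq_blk]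
  calc _ ≤ _ := hmain
    _ = _ := by ring

/-- **THE SAME IN THE CUBE CURRENCY** (Bałaban's (1.110)-type row sums over a block, natural size `N⁴`):
`blockSum_N (|Sb N x ·|) b' ≤ C·N⁴·e^{−δ·|quo_N x − b'|_∞}` for every `k ≥ 1`, `N = L^k`, `x`, block `b'`. [folklore] -/
theorem Sb_blockSum_decay_uniform (d ℓ : ℕ) (hℓ : 1 ≤ ℓ) :
    ∃ δ C : ℝ, 0 < δ ∧ 0 < C ∧ ∀ (k : ℕ), 1 ≤ k → ∀ x b' : Fin (d + 1) → ℤ,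
      blockSum ((ℓ + 1) ^ k) (fun y => |Sb (N := (ℓ + 1) ^ k) x y|) b'
        ≤ C * (((ℓ + 1) ^ k : ℕ) : ℝ) ^ 4 * Real.exp (-(δ * supNorm (quo ((ℓ + 1) ^ k) x - b'))) := by
  obtain ⟨δ, C, hδ, hC, h⟩ := landau_box_cubeDecay_indB d ℓ hℓ (m2plus := 0) le_rfl
  refine ⟨δ, C, hδ, hC, fun k hk x b' => ?_⟩
  have hn : 1 ≤ (ℓ + 1) ^ k := Nat.one_le_pow k (ℓ + 1) (Nat.succ_pos ℓ)
  have hbox : ∀ R, 1 ≤ R →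
      CubeDecay (rho (cubeM d R)) (blkBox hn (cubeM d R)) id (landauCov ((ℓ + 1) ^ k) (cubeM d R)) C δ := by
    intro R hR
    exact h k hk 0 le_rfl le_rfl (cubeM d R) (fun i => by simp only [cubeM]; omega) 1 one_pos
  have hmain := (Sb_decay_of_boxDecay hn hδ.le hbox).2 x b'
  rw [quo_eq_blk]
  calc _ ≤ _ := hmain
    _ = _ := by ring

/-! ## §4 Non-vacuity: the physical case `d + 1 = 4`, `L = 2` -/

/-- `Sb_decay_uniform` at `d + 1 = 4`, `L = 2`; the quantifier prefix is inhabited (`k = 1`, `x = x' = 0`). -/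
example : ∃ δ C : ℝ, 0 < δ ∧ 0 < C ∧ ∀ (k : ℕ), 1 ≤ k → ∀ x x' : Fin (3 + 1) → ℤ,
    |Sb (N := (1 + 1) ^ k) x x'|
      ≤ C * (((1 + 1) ^ k : ℕ) : ℝ) ^ 4 * Real.exp (-(δ * supNorm (quo ((1 + 1) ^ k) x - quo ((1 + 1) ^ k) x'))) :=
  Sb_decay_uniform 3 1 le_rfl

end
end Summit.QuantumFields.BalabanUV.Beta.GAN24.WoodburyFibreLandauZd
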